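import Summits.Ventures.CertifiedArithmetic.LowPrec.GemmThetaLawSymI

/-!
# Symbolic coverage of an integer range by a chain of intervals with affine endpoints

HONEST FRAMING (venture CertifiedArithmetic / cell `pub-lowprec`, seat gemm, gen 12 → 13): certified
error envelopes and provably optimal rounding/accumulation schemes for low-precision formats under
stated cost models; every table by two implementations; no hardware or vendor claims.

The letter-dependent symbolic θ-certificates (paper `gemm.tex` Theorems t:thetap6 / t:thetapmix, kernel
plan; interval domains in `GemmThetaLawSymI.lean`) need, besides the per-class facts, a COVERAGE lemma:
for every value of the precision symbol `K`, every trailing significand `t` of a level lies in one of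
the finitely many classes offered for a given letter.  Per residue `t ≡ r (mod 4)`, `t = 4s + r`, each
class contributes an `s`-interval `[A(K), B(K)]` with endpoints affine in `K`, and the range to be covered
is `[s_lo(K), s_hi(K)]`.  `coverChain` decides the sufficient CHAIN CRITERION
`A₁ ≤ s_lo`, `A_{i+1} ≤ B_i + 1` (consecutive), `B_n ≥ s_hi` — each an affine inequality in `K`, decided
on the `K`-domain by `nonnegOnI` (vertex `K₀` + recession slope) — and `coverChain_sound` proves that it
implies coverage at EVERY `K` of the domain; no interval needs to be non-empty (the induction keeps
`⋃_{j≤i} [A_j, B_j] ⊇ [A₁, B_i]` reading `[A, B]` as a set).  Design aid: `code/gemm/thetalaw/symsplit_proto.py`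
of the cell runs exactly this criterion for all six product alphabets (0 failures, no class with a
raised `K₀`).
-/

namespace Literature.ComputerArithmetic.FloatingPoint

namespace MiniFloat

namespace ThetaLaw

open AForm

/-- The tail of the chain criterion after an interval with right end `B`: the next interval starts at
most at `B + 1`, and so on; the last right end reaches `shi`. [cell] -/
def coverChainAux (d : IDom) (shi : AForm) : AForm → List (AForm × AForm) → Bool
  | B, [] => nonnegOnI d (B.sub shi)
  | B, (A', B') :: rest => nonnegOnI d ((B.add (const 1)).sub A') && coverChainAux d shi B' rest

/-- THE CHAIN CRITERION for `[slo, shi] ⊆ ⋃ [Aᵢ, Bᵢ]` at every `K` of the domain `d` (used with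
`T = 0`): `A₁ ≤ slo`, `A_{i+1} ≤ B_i + 1`, `B_n ≥ shi`; an empty list needs an empty range
(`slo > shi`). [cell; elementary] -/
def coverChain (d : IDom) (slo shi : AForm) : List (AForm × AForm) → Bool
  | [] => nonnegOnI d ((slo.sub shi).sub (const 1))
  | (A, B) :: rest => nonnegOnI d (slo.sub A) && coverChainAux d shi B rest

/-- Soundness of the tail: every integer above `B` and at most `shi` lies in an interval of the rest.
[cell] -/
theorem coverChainAux_sound {d : IDom} {shi : AForm} {K : ℤ} (hd : d.mem K 0) :
    ∀ (rest : List (AForm × AForm)) (B : AForm), coverChainAux d shi B rest = true →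
      ∀ s : ℤ, B.eval K 0 < s → s ≤ shi.eval K 0 →
        ∃ AB ∈ rest, AB.1.eval K 0 ≤ s ∧ s ≤ AB.2.eval K 0 := by
  intro rest
  induction rest with
  | nil =>
      intro B h s hs hshi
      unfold coverChainAux at h
      have h' := nonnegOnI_sound h hd
      simp only [eval_sub] at h'
      exact absurd hshi (by linarith)
  | cons AB rest ih =>
      obtain ⟨A', B'⟩ := AB
      intro B h s hs hshi
      unfold coverChainAux at h
      simp only [Bool.and_eq_true] at h
      obtain ⟨h1, h2⟩ := h
      have h1' := nonnegOnI_sound h1 hd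
      simp only [eval_sub, eval_add, eval_const] at h1'
      by_cases hsB : s ≤ B'.eval K 0
      · exact ⟨(A', B'), by simp, by simp only; linarith, hsB⟩
      · obtain ⟨AB, hmem, hAB⟩ := ih B' h2 s (lt_of_not_ge hsB) hshi
        exact ⟨AB, List.mem_cons_of_mem _ hmem, hAB⟩

/-- SOUNDNESS OF THE CHAIN CRITERION: at every `K` of the domain, every integer of `[slo(K), shi(K)]`
lies in one of the intervals. [cell] -/
theorem coverChain_sound {d : IDom} {slo shi : AForm} {ivs : List (AForm × AForm)} {K : ℤ}
    (h : coverChain d slo shi ivs = true) (hd : d.mem K 0) :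
    ∀ s : ℤ, slo.eval K 0 ≤ s → s ≤ shi.eval K 0 →
      ∃ AB ∈ ivs, AB.1.eval K 0 ≤ s ∧ s ≤ AB.2.eval K 0 := by
  intro s hlo hhi
  cases ivs with
  | nil =>
      unfold coverChain at h
      have h' := nonnegOnI_sound h hd
      simp only [eval_sub, eval_const] at h'
      exact absurd hhi (by linarith)
  | cons AB rest =>
      obtain ⟨A, B⟩ := AB
      unfold coverChain at h
      simp only [Bool.and_eq_true] at h
      obtain ⟨h1, h2⟩ := h
      have h1' := nonnegOnI_sound h1 hd
      simp only [eval_sub] at h1'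
      by_cases hsB : s ≤ B.eval K 0
      · exact ⟨(A, B), by simp, by simp only; linarith, hsB⟩
      · obtain ⟨AB, hmem, hAB⟩ := coverChainAux_sound hd rest B h2 s (lt_of_not_ge hsB) hhi
        exact ⟨AB, List.mem_cons_of_mem _ hmem, hAB⟩

/-- The `K`-only domain `K ≥ K₀` (or `K = K₀`), `T = 0`, on which coverage inequalities are decided.
[cell] -/
def kDom (K0 : ℤ) (fixed : Bool) : IDom := ⟨K0, fixed, false, 0, 0, 0, 0⟩

/-- Membership in the `K`-only domain. [cell] -/
theorem kDom_mem {K0 K : ℤ} {fixed : Bool} (hK : K0 ≤ K) (hfix : fixed = true → K = K0) :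
    (kDom K0 fixed).mem K 0 :=
  ⟨hfix, hK, fun h => absurd h (by simp [kDom]), fun _ => rfl⟩

/-- Sanity (kernel-checked): for `K ≥ 2` the range `[0, 16K - 1]` is covered by the chain
`[0, 4K + 3]`, `[4K + 2, 4K + 1]` (EMPTY for every `K` — the criterion does not mind), `[4K, 12K]`,
`[12K + 1, 16K + 7]`; and dropping the third interval breaks the chain. [cell] -/
theorem coverChain_values :
    coverChain (kDom 2 false) ⟨0, 0, 0⟩ ⟨-1, 16, 0⟩
        [(⟨0, 0, 0⟩, ⟨3, 4, 0⟩), (⟨2, 4, 0⟩, ⟨1, 4, 0⟩), (⟨0, 4, 0⟩, ⟨0, 12, 0⟩),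
          (⟨1, 12, 0⟩, ⟨7, 16, 0⟩)] = true ∧
    coverChain (kDom 2 false) ⟨0, 0, 0⟩ ⟨-1, 16, 0⟩
        [(⟨0, 0, 0⟩, ⟨3, 4, 0⟩), (⟨2, 4, 0⟩, ⟨1, 4, 0⟩), (⟨1, 12, 0⟩, ⟨7, 16, 0⟩)] = false := by
  decide

end ThetaLaw

end MiniFloat

end Literature.ComputerArithmetic.FloatingPoint
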